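import Literature.AnabelianGeometry.SemiGraphs.TemperedPiRayApartment
import Literature.AnabelianGeometry.SemiGraphs.TemperedPiPointStabilizerCore
import Literature.AnabelianGeometry.SemiGraphs.TemperedPiCompactnessCriterion
import HarnessLib

/-!
# Level coincidence of the edge generators of a ray ([SemiAnbd] Thm 3.7 (iii), p. 41)

Mochizuki, *Semi-graphs of anabelioids*, Publ. RIMS **42** (2006) [MochizukiSemiAnbd2006], proof of
Theorem 3.7 (iii), author's manuscript p. 41 ("`H` acts continuously on the semi-graph `𝒢_{∞,i}` … this
action factors through a finite quotient"). [cite: MochizukiSemiAnbd2006, Thm 3.7(iii) p.41]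

PROOF-ONLY file (abc-iut cell, FRONTIER programme REFUTE-F1732, brick R6c «JUNCTION (BS2)»; seat
abc-iut-L3-t11 gen 3; no definitions, no named facts).  For a Galois tower `D : GaloisLevelData 𝒢`
(abc-iut-L3-t9), the APARTMENT along a ray of closed edges (`TemperedPiRayApartment.lean`: point sequences
`rayPointSeq k` over `v k` with decomposition homomorphisms `ψ_k`, aligned: `ψ_{k+1} ∘ (βp k)_* = ψ_k ∘ (βm k)_*`)
and EDGE GENERATORS `z k = ψ_{k+1}((βp k)_* (x₀ k))` (a sequence `z` given with this description, binder
`hz`), the binder (hz) «eventual agreement of the level components» of abc-iut-L3-d4's escape assembly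
`thetaRay_not_compactInVerticialAt_of_levelEscape` (`ThetaRayEscape.lean`), produced GENERICALLY from a
membership in the characteristic open core:

* `proj_raySeq_succ_eq_of_mem_charOpenCore` — (BS2) `ρ_m (z (k+1)) = ρ_m (z k)` as soon as
  `((βm (k+1))_* x₀(k+1))⁻¹ · (βp k)_* x₀(k) ∈ charOpenCore Π_{v(k+1)} (#(S m)_{v(k+1)})` (the alignment +
  `charOpenCore ≤ Stab`, `TemperedPiPointStabilizerCore.lean`), also in `treeAct` form;
* `eventually_proj_raySeq_succ_eq` — hence, if at every level `m` this membership holds for all `k ≥ N_m`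
  (finite level fibres), `∀ m, ∃ N, ∀ k ≥ N, ρ_m (z (k+1)) = ρ_m (z k)`: VERBATIM the binder `hz`;
* `exists_rayLimit`, `treeAct_rayLimit_fixes` — the limit element `c` (abc-iut-w4-d071's
  `exists_forall_eventually_projAut_eq`) and «whatever `z k` fixes at level `m` for `k ≥ N_m`, `c` fixes»
  (for consumers that want the limit explicitly; `ThetaRayEscape` builds it internally).

The other level-wise binders are elsewhere: (hfin)/(hfar) in abc-iut-w5-d160's
`TemperedPiRayApartmentLevelFiniteness.lean`, (hcrit) via abc-iut-L3-t11's `TemperedPiBranchStabilizerImage.lean`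
and abc-iut-L3-d4's `ThetaRayCriticalSubjoint.lean`.  At the desk countermodel `𝒢_θ` of abc-iut-L3-d1 (memo
HOME/staging/L3/L3-d1/g3/COUNTERMODEL-Thm37iii-infinite.md) `x₀ k = 1 ∈ ℤ_p` and the membership is
`b^{-p^{n_{k+1}}} ∈ charOpenCore` (R1b) — towards a kernel erratum for the ∀-countable reading of [SemiAnbd]
Thm 3.7 (iii) ([IUTchI] Rmk 2.5.3); print proves finite `𝔾` (kernel: `compactInVerticialAt_of_finiteGraph`).
Nothing here bears on [IUTchIII] Cor. 3.12; typed ≠ proved.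
-/


namespace Literature.AnabelianGeometry.SemiGraphs

namespace ProfiniteSemiGraph

namespace GaloisLevelData

open CategoryTheory Topology

universe u

variable {𝒢 : ProfiniteSemiGraph.{u}} {D : GaloisLevelData 𝒢} {h𝒢 : 𝒢.IsCountable}

/-! ### Elements with eventually constant level components along a sequence -/

/-- If `ρ_m c = ρ_m g` then `c` and `g` act identically on the tree `𝔾̃_m`.
[cite: MochizukiSemiAnbd2006, Thm 3.7(iii) p.41] -/
theorem treeAct_eq_of_proj_eq (m : ℕ) {c g : D.temperedPi h𝒢} (h : D.proj h𝒢 m c = D.proj h𝒢 m g) :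
    D.treeAct h𝒢 m c = D.treeAct h𝒢 m g := by
  rw [D.treeAct_apply, D.treeAct_apply, h]

/-! ### The junction along a ray: coincidence, limit, far fixed vertices -/

section Ray

variable (hc : 𝒢.graph.IsConnected)
  {v : ℕ → 𝒢.graph.Vertex} {βm βp : ℕ → 𝒢.graph.Branch}
  (ham : ∀ k, 𝒢.graph.abuts (βm k) = some (v k))
  (hap : ∀ k, 𝒢.graph.abuts (βp k) = some (v (k + 1)))
  (hmp : ∀ k, 𝒢.graph.edgeOf (βp k) = 𝒢.graph.edgeOf (βm k))
  (P₀ : D.PointSeq h𝒢 (v 0))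
  (x₀ : ∀ k, 𝒢.Ge (𝒢.graph.edgeOf (βp k)))
  (z : ℕ → D.temperedPi h𝒢)
  (hz : ∀ k, z k = (rayPointSeq ham hap hmp P₀ (k + 1)).decompHom
    (𝒢.brHom (βp k) (v (k + 1)) (hap k) (x₀ k)))

include hc hz in
/-- **(BS2) Level coincidence of consecutive edge generators**: `ρ_m (z (k+1)) = ρ_m (z k)` as soon as
`((βm (k+1))_* x₀(k+1))⁻¹ · (βp k)_* x₀(k) ∈ charOpenCore Π_{v(k+1)} (#(S m)_{v(k+1)})` — by the alignment
`z (k+1) = ψ_{k+1}((βm (k+1))_* x₀(k+1))` and `charOpenCore ≤ Stab` (finite level fibre).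
[cite: MochizukiSemiAnbd2006, Thm 3.7(iii) p.41] -/
theorem proj_raySeq_succ_eq_of_mem_charOpenCore (k m : ℕ) [Finite ((D.S m).SV (v (k + 1))).obj.V]
    (hmem : (𝒢.brHom (βm (k + 1)) (v (k + 1)) (ham (k + 1)) (hmp (k + 1) ▸ x₀ (k + 1)))⁻¹ *
        𝒢.brHom (βp k) (v (k + 1)) (hap k) (x₀ k) ∈
      charOpenCore (𝒢.Gv (v (k + 1))) (Nat.card ((D.S m).SV (v (k + 1))).obj.V)) :
    D.proj h𝒢 m (z (k + 1)) = D.proj h𝒢 m (z k) := by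
  rw [hz (k + 1), hz k, decompHom_brHom_succ_eq hc ham hap hmp P₀ (k + 1) (x₀ (k + 1))]
  exact (rayPointSeq ham hap hmp P₀ (k + 1)).proj_decompHom_eq_of_mem_charOpenCore m _ _ hmem

include hc hz in
/-- (BS2) in `treeAct` form (abc-iut-L3-d1's R6-SPEC: «`D.act j z_k = D.act j z_{k+1}`»).
[cite: MochizukiSemiAnbd2006, Thm 3.7(iii) p.41] -/
theorem treeAct_raySeq_succ_eq_of_mem_charOpenCore (k m : ℕ) [Finite ((D.S m).SV (v (k + 1))).obj.V]
    (hmem : (𝒢.brHom (βm (k + 1)) (v (k + 1)) (ham (k + 1)) (hmp (k + 1) ▸ x₀ (k + 1)))⁻¹ *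
        𝒢.brHom (βp k) (v (k + 1)) (hap k) (x₀ k) ∈
      charOpenCore (𝒢.Gv (v (k + 1))) (Nat.card ((D.S m).SV (v (k + 1))).obj.V)) :
    D.treeAct h𝒢 m (z (k + 1)) = D.treeAct h𝒢 m (z k) :=
  treeAct_eq_of_proj_eq m (proj_raySeq_succ_eq_of_mem_charOpenCore hc ham hap hmp P₀ x₀ z hz k m hmem)

include hc hz in
/-- **The binder (hz) of `thetaRay_not_compactInVerticialAt_of_levelEscape`, generically**: if at every
level `m` the membership `((βm (k+1))_* x₀(k+1))⁻¹ · (βp k)_* x₀(k) ∈ charOpenCore Π_{v(k+1)} (#(S m)_{v(k+1)})`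
holds for all `k ≥ N_m` (finite level fibres), then `∀ m, ∃ N, ∀ k ≥ N, ρ_m (z (k+1)) = ρ_m (z k)`.
[cite: MochizukiSemiAnbd2006, Thm 3.7(iii) p.41] -/
theorem eventually_proj_raySeq_succ_eq (hfin : ∀ (m : ℕ) (k : ℕ), Finite ((D.S m).SV (v (k + 1))).obj.V)
    (hcoin : ∀ m, ∃ N, ∀ k, N ≤ k →
      (𝒢.brHom (βm (k + 1)) (v (k + 1)) (ham (k + 1)) (hmp (k + 1) ▸ x₀ (k + 1)))⁻¹ *
          𝒢.brHom (βp k) (v (k + 1)) (hap k) (x₀ k) ∈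
        charOpenCore (𝒢.Gv (v (k + 1))) (Nat.card ((D.S m).SV (v (k + 1))).obj.V)) :
    ∀ m, ∃ N, ∀ k, N ≤ k → D.proj h𝒢 m (z (k + 1)) = D.proj h𝒢 m (z k) := by
  intro m
  obtain ⟨N, hN⟩ := hcoin m
  refine ⟨N, fun k hk => ?_⟩
  haveI := hfin m k
  exact proj_raySeq_succ_eq_of_mem_charOpenCore hc ham hap hmp P₀ x₀ z hz k m (hN k hk)

include hc hz in
/-- **(BS3) The limit element**: if the coincidence hypothesis holds for all `k ≥ N_m` at every level `m`
(finite level fibres), there is `c ∈ π₁^temp(𝒢)` whose level-`m` component is that of `z k` for all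
`k ≥ N_m`. [cite: MochizukiSemiAnbd2006, Thm 3.7(iii) p.41] -/
theorem exists_rayLimit (hfin : ∀ (m : ℕ) (k : ℕ), Finite ((D.S m).SV (v (k + 1))).obj.V)
    (hcoin : ∀ m, ∃ N, ∀ k, N ≤ k →
      (𝒢.brHom (βm (k + 1)) (v (k + 1)) (ham (k + 1)) (hmp (k + 1) ▸ x₀ (k + 1)))⁻¹ *
          𝒢.brHom (βp k) (v (k + 1)) (hap k) (x₀ k) ∈
        charOpenCore (𝒢.Gv (v (k + 1))) (Nat.card ((D.S m).SV (v (k + 1))).obj.V)) :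
    ∃ c : D.temperedPi h𝒢, ∀ m, ∃ N, ∀ k, N ≤ k → D.proj h𝒢 m c = D.proj h𝒢 m (z k) :=
  D.exists_forall_eventually_projAut_eq h𝒢 z
    (eventually_proj_raySeq_succ_eq hc ham hap hmp P₀ x₀ z hz hfin hcoin)

include hc hz in
/-- **Whatever `z k` fixes, `c` fixes (vertices)**: for `k ≥ N_m`, `c` fixes the apartment vertices
`(rayPointSeq k).vertex m` and `(rayPointSeq (k+1)).vertex m` at level `m`.
[cite: MochizukiSemiAnbd2006, Thm 3.7(iii) p.41] -/
theorem treeAct_rayLimit_fixes (c : D.temperedPi h𝒢) (m k : ℕ) (hck : D.proj h𝒢 m c = D.proj h𝒢 m (z k)) :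
    (D.treeAct h𝒢 m c).hom.vertexMap ((rayPointSeq ham hap hmp P₀ k).vertex m) =
        (rayPointSeq ham hap hmp P₀ k).vertex m ∧
      (D.treeAct h𝒢 m c).hom.edgeMap ((rayEdgeSeq ham hap hmp P₀ k).edge m) =
        (rayEdgeSeq ham hap hmp P₀ k).edge m ∧
      (D.treeAct h𝒢 m c).hom.vertexMap ((rayPointSeq ham hap hmp P₀ (k + 1)).vertex m) =
        (rayPointSeq ham hap hmp P₀ (k + 1)).vertex m := by
  rw [treeAct_eq_of_proj_eq m hck, hz k]
  exact treeAct_rayGen_fixes hc ham hap hmp P₀ k m (x₀ k)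

end Ray

end GaloisLevelData

end ProfiniteSemiGraph

end Literature.AnabelianGeometry.SemiGraphs
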